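import Mathlib
import HarnessLib
import Summits.HubbardSuperconductivity.HubbardSuperconductivity.Theorems.KLProgrammeKLRegimeVolumeLimitTranslationInvariance

/-!
# Space–time translation invariance at finite cutoff for an ARBITRARY word of position–time fields (seat hubbard-kl-k3c5-p2, g2)

Route `KLProgramme`, gen-4 child 5 `KLRegimeVolumeLimitV12` (stmt-HubbardSuperconductivity-19858), `stub_vl_bound`, piece (F) of the lane's cut
(k3c5-p1 g4, HOME/STATUS 2026-08-27T00:37:35Z): the finite-`M` time representation of the six-point (current–current) term needs the
translation covariance of expectations of words of LOCAL CUBIC currents.  `…TranslationInvariance` proved it for the local pair; the same Nambu-odd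
phase substitution `θ_u` gives it for every finite word (`gaussExpect_positionWord_translate`):

  `∫dμ_{C_M} (∏_l ψ^{c_l}_{(y_l + a, s_l + s₀)σ_l}) e^{−V} = ∫dμ_{C_M} (∏_l ψ^{c_l}_{(y_l, s_l)σ_l}) e^{−V}`

for every list of legs `(c_l, σ_l, y_l, s_l)`, every shift `(a, s₀) ∈ 𝕋_L × ℝ`, every cutoff `M`, every real `U` (bare covariance, seed `0`).
Everything is proved; no definition.
-/

noncomputable section

namespace Summit.HubbardSuperconductivity.HubbardSuperconductivity.Theorems.TwoPointAssembly

set_option linter.dupNamespace false -- summit = problem name (single-conjunct summit), D-0017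

open Finset Literature.MathematicalPhysics.QuantumLattice Literature.Probability.LatticeModels GrassmannAlgebra

variable {L M : ℕ} [NeZero L]

/-- The phase substitution shifts a position–time field of either charge. -/
theorem map_phaseDiag_positionField (β s₀ : ℝ) (a : TorusSite 2 L) (c σ : Fin 2) (y : TorusSite 2 L) (s : ℝ) :
    ExteriorAlgebra.map (Matrix.toLin' (Matrix.diagonal fun X : HubbardFieldIdx L M =>
        if X.2 = 0 then Complex.exp (((matsubaraFreq β M X.1.1.1 * s₀ : ℝ) : ℂ) * Complex.I) * torusChar X.1.1.2 a
        else (Complex.exp (((matsubaraFreq β M X.1.1.1 * s₀ : ℝ) : ℂ) * Complex.I) * torusChar X.1.1.2 a)⁻¹))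
        (positionField L M β c σ y s) = positionField L M β c σ (y + a) (s + s₀) := by
  fin_cases c
  · exact map_phaseDiag_positionField_zero β s₀ a σ y s
  · exact map_phaseDiag_positionField_one β s₀ a σ y s

/-- **TRANSLATION INVARIANCE FOR EVERY WORD OF POSITION–TIME FIELDS** (finite cutoff, bare covariance, every real `U`):
shifting all legs by `(a, s₀)` does not change `∫dμ_C (∏ legs) e^{−V}`. -/
theorem gaussExpect_positionWord_translate (β U μ s₀ : ℝ) (a : TorusSite 2 L)
    (legs : List (Fin 2 × Fin 2 × TorusSite 2 L × ℝ)) :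
    gaussExpect ℂ (hubbardCovariance L M β μ 0)
        ((legs.map fun q => positionField L M β q.1 q.2.1 (q.2.2.1 + a) (q.2.2.2 + s₀)).prod *
          grassmannExp (-(hubbardInteraction L M β U))) =
      gaussExpect ℂ (hubbardCovariance L M β μ 0)
        ((legs.map fun q => positionField L M β q.1 q.2.1 q.2.2.1 q.2.2.2).prod * grassmannExp (-(hubbardInteraction L M β U))) := by
  have hu : ∀ k : FreqMomentum L M, Complex.exp (((matsubaraFreq β M k.1 * s₀ : ℝ) : ℂ) * Complex.I) * torusChar k.2 a ≠ 0 := by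
    intro k
    refine mul_ne_zero (Complex.exp_ne_zero _) fun hq => ?_
    have := norm_torusChar k.2 a; rw [hq, norm_zero] at this; exact zero_ne_one this
  have hC := phaseDiag_covariance_invariant (L := L) (M := M)
    (fun k : FreqMomentum L M => Complex.exp (((matsubaraFreq β M k.1 * s₀ : ℝ) : ℂ) * Complex.I) * torusChar k.2 a) hu
    (fun k => phase_nambu_odd β s₀ a k) β μ 0
  have hV := map_phaseDiag_hubbardInteraction (L := L) (M := M) β U
    (fun k : FreqMomentum L M => Complex.exp (((matsubaraFreq β M k.1 * s₀ : ℝ) : ℂ) * Complex.I) * torusChar k.2 a)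
    (fun k₁ k₂ k₃ k₄ h => phase_conserving β s₀ a k₁ k₂ k₃ k₄ h)
  have hprod : ExteriorAlgebra.map (Matrix.toLin' (Matrix.diagonal fun X : HubbardFieldIdx L M =>
        if X.2 = 0 then Complex.exp (((matsubaraFreq β M X.1.1.1 * s₀ : ℝ) : ℂ) * Complex.I) * torusChar X.1.1.2 a
        else (Complex.exp (((matsubaraFreq β M X.1.1.1 * s₀ : ℝ) : ℂ) * Complex.I) * torusChar X.1.1.2 a)⁻¹))
        ((legs.map fun q => positionField L M β q.1 q.2.1 q.2.2.1 q.2.2.2).prod) =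
      (legs.map fun q => positionField L M β q.1 q.2.1 (q.2.2.1 + a) (q.2.2.2 + s₀)).prod := by
    rw [map_list_prod, List.map_map]
    congr 1
    refine List.map_congr_left fun q _ => ?_
    exact map_phaseDiag_positionField β s₀ a q.1 q.2.1 q.2.2.1 q.2.2.2
  have hθ : ExteriorAlgebra.map (Matrix.toLin' (Matrix.diagonal fun X : HubbardFieldIdx L M =>
        if X.2 = 0 then Complex.exp (((matsubaraFreq β M X.1.1.1 * s₀ : ℝ) : ℂ) * Complex.I) * torusChar X.1.1.2 a
        else (Complex.exp (((matsubaraFreq β M X.1.1.1 * s₀ : ℝ) : ℂ) * Complex.I) * torusChar X.1.1.2 a)⁻¹))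
        ((legs.map fun q => positionField L M β q.1 q.2.1 q.2.2.1 q.2.2.2).prod * grassmannExp (-(hubbardInteraction L M β U))) =
      (legs.map fun q => positionField L M β q.1 q.2.1 (q.2.2.1 + a) (q.2.2.2 + s₀)).prod *
        grassmannExp (-(hubbardInteraction L M β U)) := by
    rw [map_mul, hprod, map_grassmannExp_eq, map_neg, hV]
  rw [← hθ, gaussExpect_map_toLin', hC]

end Summit.HubbardSuperconductivity.HubbardSuperconductivity.Theorems.TwoPointAssembly

end
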